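import Summits.AtomisticToContinuum.BoseEinsteinCondensation.Theorems.BECInsertionCorrectorCorrectorClosureVolumeHomotopyReduction
import Summits.AtomisticToContinuum.BoseEinsteinCondensation.Theorems.BECInsertionCorrectorCorrectorClosureZeroModeFSum
import Summits.AtomisticToContinuum.BoseEinsteinCondensation.Theorems.BECInsertionCorrectorCorrectorClosureConcentrationOfMoments
import Summits.AtomisticToContinuum.BoseEinsteinCondensation.Theorems.BECInsertionCorrectorCorrectorClosureZeroModeSusceptibilityOfTorusGap
import HarnessLib

/-!
# Crux `CorrectorClosure` (stmt-AtomisticToContinuum-12058), line `volume-homotopy-sum-rule-domination` —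
# the cycle-1 milestone: K1 ∧ IR remainders ∧ (torus gap ≥ C/L³) ⊢ torus BEC (kernel-checked)

Supports (does not close) stmt-AtomisticToContinuum-12058, route `BECInsertionCorrector`.

After waves 1–3 of lead a5 the picked line has FOUR open registered stubs (skeleton v4): S2 (12615′, the
density-uniform non-condensate IR remainders), S3b (the static susceptibility of the condensate number `N̂₀`),
R (the regular zero-mode removal susceptibility) and the hole S7. This file composes the landed pieces into the
two statements a planner will want to cite (D-0014):

* `periodicBEC_of_K1_remainders_gap` — **`StaticResponseBound` ∧ 12615′(v) ∧ [torus Ky Fan gap ≥ C/L³ for every C,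
  density-uniformly](v) ⊢ torus BEC of near-minimisers at every smooth-class `v`** (body of `PeriodicBEC`, item 8997,
  `c = 1/2`). Inputs: `periodicBEC_of_densityUniformHearts` (p136219: K1 via `stub_longWaveStructureOfSRB`, the engine
  `stub_densityUniformDichotomy`, the bootstrap `stub_volumeBootstrap`), the zero-mode moment module
  `stub_concentrationOfMoments` (p137298) with the LANDED f-sum `stub_zeroModeFSum` (p138165) and the gap route
  `zeroModeSusceptibility_of_torusGap` (p139068). So, modulo K1, torus BEC on the smooth class is reduced to ONE
  4-point infrared statement (12615′) and ONE spectral statement (gap `≫ L⁻³`; expected `≈ e_(2π/L) ≥ 4π²/L²`).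
* `correctorClosure_of_K1_remainders_gap_removal` — the crux BY NAME from [∀ smooth v: 12615′ ∧ gap] ∧
  [∀ bounded v: R] ∧ [S7]: `correctorClosure_of_densityUniformHearts` (p136384) with S3 discharged as above.

Both are CONDITIONAL (credit nothing); the hypotheses are verbatim the registered stub signatures S2, R, S7 and
the gap body of p139068.
-/

noncomputable section

open MeasureTheory Filter Matrix
open scoped ENNReal NNReal BigOperators ComplexConjugate

namespace Summit.AtomisticToContinuum.BoseEinsteinCondensation.Theorems.CorrectorClosure.VolumeHomotopySumRuleDomination

open Literature.MathematicalPhysics.QuantumManyBody.BoseGas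
open Summit.AtomisticToContinuum.BoseEinsteinCondensation.Theses.BECInsertionCorrector

/-- **Torus BEC from K1, the IR remainders and a gap `≫ L⁻³` (smooth class).** See the module docstring.
[folklore] -/
theorem periodicBEC_of_K1_remainders_gap (hK1 : StaticResponseBound) (v : ℝ → ℝ≥0∞)
    (hv : IsRepulsiveFiniteRange v) (hfin : ∀ r, v r ≠ ⊤) (hC2 : ContDiff ℝ 2 (fun x : Space => (v ‖x‖).toReal))
    (hedge : ∃ Cₑ : ℝ, ∀ x : Space,
      ‖iteratedFDeriv ℝ 2 (fun x : Space => (v ‖x‖).toReal) x‖ ≤ Cₑ * Real.sqrt ((v ‖x‖).toReal))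
    (hR : ∀ Λ : ℝ, 0 < Λ → ∀ ε : ℝ, 0 < ε → ∃ ρ₀ : ℝ, 0 < ρ₀ ∧ ∀ᶠ N : ℕ in atTop, ∀ L : ℝ,
      sideLength ρ₀ N ≤ L → ∀ Ψ : PeriodicTrialState N L,
      periodicEnergy v Ψ = periodicGroundStateEnergy v N L → periodicEnergy v Ψ ≠ ⊤ →
      (∑' n : Fin 3 → ℤ,
      {n : Fin 3 → ℤ | n ≠ 0 ∧ ‖((2 * Real.pi / L) • latticeVec 1 n)‖ <
      Λ * Real.sqrt ((N : ℝ) / L ^ 3 * (scatteringLength v).toReal)}.indicator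
      (fun n =>
      (∫⁻ X in cellN N L,
      (‖∑ j : Fin N,
      (cellWave L n (X j) *
      ((-2 * Complex.I) * fderiv ℝ Ψ.ψ X (Pi.single j ((2 * Real.pi / L) • latticeVec 1 n)) +
      (((‖((2 * Real.pi / L) • latticeVec 1 n)‖ ^ 2 : ℝ)) : ℂ) *
      (Ψ.ψ X - (((L ^ 3)⁻¹ : ℝ) : ℂ) * ∫ y in cell L, Ψ.ψ (Function.update X j y))) +
      (((‖((2 * Real.pi / L) • latticeVec 1 n)‖ ^ 2 : ℝ)) : ℂ) *
      ((((L ^ 3)⁻¹ : ℝ) : ℂ) *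
      ∫ y in cell L, cellWave L n y * Ψ.ψ (Function.update X j y)))‖₊ : ℝ≥0∞) ^ 2) /
      ENNReal.ofReal (‖((2 * Real.pi / L) • latticeVec 1 n)‖ ^ 4) +
      (∫⁻ X in cellN N L,
      (‖∑ j : Fin N,
      (cellWave L n (X j) *
      (Ψ.ψ X - (((L ^ 3)⁻¹ : ℝ) : ℂ) * ∫ y in cell L, Ψ.ψ (Function.update X j y)) -
      (((L ^ 3)⁻¹ : ℝ) : ℂ) *
      ∫ y in cell L, cellWave L n y * Ψ.ψ (Function.update X j y))‖₊ : ℝ≥0∞) ^ 2))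
      n) ≤
      ENNReal.ofReal (ε * (N : ℝ) ^ 2))
    (hGap : ∀ C : ℝ, 0 < C → ∃ ρ₀ : ℝ, 0 < ρ₀ ∧ ∀ᶠ n : ℕ in atTop, ∀ L : ℝ,
      sideLength ρ₀ (n + 2) ≤ L →
      2 * periodicGroundStateEnergy v (n + 2) L + ENNReal.ofReal (C / L ^ 3) ≤ kyFanTwo v (n + 2) L) :
    ∃ ρ₀ : ℝ, 0 < ρ₀ ∧ ∀ ρ : ℝ, 0 < ρ → ρ < ρ₀ → ∃ c : ℝ, 0 < c ∧ ∀ᶠ N : ℕ in atTop,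
      ∃ δ : ℝ≥0∞, 0 < δ ∧ ∀ Ψ : PeriodicTrialState N (sideLength ρ N),
        periodicEnergy v Ψ ≤ periodicGroundStateEnergy v N (sideLength ρ N) + δ →
        ENNReal.ofReal (c * N) ≤ condensateOccupation N (sideLength ρ N) Ψ.ψ :=
  periodicBEC_of_densityUniformHearts hK1 v hv hfin hC2 hedge hR
    (stub_concentrationOfMoments v hv hfin hC2 hedge (stub_zeroModeFSum v hv hfin hC2 hedge)
      (zeroModeSusceptibility_of_torusGap v hv hfin hC2 hedge hGap))

/-- **`CorrectorClosure` from K1-consuming inputs: [∀ smooth v: 12615′ ∧ gap ≫ L⁻³] ∧ [∀ bounded v: R] ∧ S7.**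
See the module docstring. [folklore] -/
theorem correctorClosure_of_K1_remainders_gap_removal
    (h₂ : ∀ v : ℝ → ℝ≥0∞, IsRepulsiveFiniteRange v → (∀ r, v r ≠ ⊤) → ContDiff ℝ 2 (fun x : Space => (v ‖x‖).toReal) →
      (∃ Cₑ : ℝ, ∀ x : Space,
        ‖iteratedFDeriv ℝ 2 (fun x : Space => (v ‖x‖).toReal) x‖ ≤ Cₑ * Real.sqrt ((v ‖x‖).toReal)) →
      ∀ Λ : ℝ, 0 < Λ → ∀ ε : ℝ, 0 < ε → ∃ ρ₀ : ℝ, 0 < ρ₀ ∧ ∀ᶠ N : ℕ in atTop, ∀ L : ℝ,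
      sideLength ρ₀ N ≤ L → ∀ Ψ : PeriodicTrialState N L,
      periodicEnergy v Ψ = periodicGroundStateEnergy v N L → periodicEnergy v Ψ ≠ ⊤ →
      (∑' n : Fin 3 → ℤ,
      {n : Fin 3 → ℤ | n ≠ 0 ∧ ‖((2 * Real.pi / L) • latticeVec 1 n)‖ <
      Λ * Real.sqrt ((N : ℝ) / L ^ 3 * (scatteringLength v).toReal)}.indicator
      (fun n =>
      (∫⁻ X in cellN N L,
      (‖∑ j : Fin N,
      (cellWave L n (X j) *
      ((-2 * Complex.I) * fderiv ℝ Ψ.ψ X (Pi.single j ((2 * Real.pi / L) • latticeVec 1 n)) +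
      (((‖((2 * Real.pi / L) • latticeVec 1 n)‖ ^ 2 : ℝ)) : ℂ) *
      (Ψ.ψ X - (((L ^ 3)⁻¹ : ℝ) : ℂ) * ∫ y in cell L, Ψ.ψ (Function.update X j y))) +
      (((‖((2 * Real.pi / L) • latticeVec 1 n)‖ ^ 2 : ℝ)) : ℂ) *
      ((((L ^ 3)⁻¹ : ℝ) : ℂ) *
      ∫ y in cell L, cellWave L n y * Ψ.ψ (Function.update X j y)))‖₊ : ℝ≥0∞) ^ 2) /
      ENNReal.ofReal (‖((2 * Real.pi / L) • latticeVec 1 n)‖ ^ 4) +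
      (∫⁻ X in cellN N L,
      (‖∑ j : Fin N,
      (cellWave L n (X j) *
      (Ψ.ψ X - (((L ^ 3)⁻¹ : ℝ) : ℂ) * ∫ y in cell L, Ψ.ψ (Function.update X j y)) -
      (((L ^ 3)⁻¹ : ℝ) : ℂ) *
      ∫ y in cell L, cellWave L n y * Ψ.ψ (Function.update X j y))‖₊ : ℝ≥0∞) ^ 2))
      n) ≤
      ENNReal.ofReal (ε * (N : ℝ) ^ 2))
    (hGap : ∀ v : ℝ → ℝ≥0∞, IsRepulsiveFiniteRange v → (∀ r, v r ≠ ⊤) → ContDiff ℝ 2 (fun x : Space => (v ‖x‖).toReal) →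
      (∃ Cₑ : ℝ, ∀ x : Space,
        ‖iteratedFDeriv ℝ 2 (fun x : Space => (v ‖x‖).toReal) x‖ ≤ Cₑ * Real.sqrt ((v ‖x‖).toReal)) →
      ∀ C : ℝ, 0 < C → ∃ ρ₀ : ℝ, 0 < ρ₀ ∧ ∀ᶠ n : ℕ in atTop, ∀ L : ℝ,
      sideLength ρ₀ (n + 2) ≤ L →
      2 * periodicGroundStateEnergy v (n + 2) L + ENNReal.ofReal (C / L ^ 3) ≤ kyFanTwo v (n + 2) L)
    (hRRS : ∀ v : ℝ → ℝ≥0∞, IsRepulsiveFiniteRange v → (∃ C : ℝ≥0, ∀ r, v r ≤ C) →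
      ∃ ρ₃ : ℝ, 0 < ρ₃ ∧ ∀ ρ : ℝ, 0 < ρ → ρ < ρ₃ → ∃ η : ℝ, 0 ≤ η ∧ η < 1 ∧
      ∀ᶠ N : ℕ in atTop, ∀ (L : ℝ), L = sideLength ρ (N + 1) →
      (∃ C : ℝ≥0, ∀ x, periodizedPotential v L x ≤ C) →
      ∀ (Θ₀ : Config N → ℝ), IsPeriodicGroundStateFK v L Θ₀ → Continuous Θ₀ → (∀ X, 0 < Θ₀ X) →
      ∀ (Φ₀ : Config (N + 1) → ℝ), IsPeriodicGroundStateFK v L Φ₀ → Continuous Φ₀ →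
      (∀ X, 0 < Φ₀ X) →
      ∀ (G : Config N → ℝ), (G = fun X => ∫ x in cell L, Φ₀ (vecCons x X)) →
      ∃ B : ℝ, 0 ≤ B ∧
      hMinusOneSqW L Θ₀ (fun X => G X / Θ₀ X - ∫ Y in cellN N L, Θ₀ Y * G Y) ≤
      ENNReal.ofReal B ∧
      ((periodicGroundStateEnergy v (N + 1) L).toReal
      - (periodicGroundStateEnergy v N L).toReal) * B ≤
      η * ∫ X in cellN N L, G X ^ 2)
    (hHole : StaticResponseBound → ∀ v : ℝ → ℝ≥0∞, IsRepulsiveFiniteRange v →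
      ¬ ((∀ r, v r ≠ ⊤) ∧ ContDiff ℝ 2 (fun x : Space => (v ‖x‖).toReal) ∧
      (∃ Cₑ : ℝ, ∀ x : Space,
      ‖iteratedFDeriv ℝ 2 (fun x : Space => (v ‖x‖).toReal) x‖ ≤ Cₑ * Real.sqrt ((v ‖x‖).toReal)) ∧
      (∃ M : ℝ≥0, ∀ r, v r ≤ M)) →
      ∃ ρ₀ : ℝ, 0 < ρ₀ ∧ ∀ ρ : ℝ, 0 < ρ → ρ < ρ₀ → ∃ c : ℝ, 0 < c ∧ ∀ᶠ N : ℕ in Filter.atTop,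
      ∃ δ : ENNReal, 0 < δ ∧ ∃ Θ : PeriodicTrialState N (sideLength ρ (N + 1)),
      periodicEnergy v Θ ≤ periodicGroundStateEnergy v N (sideLength ρ (N + 1)) + δ ∧
      ∀ Ψ : PeriodicTrialState (N + 1) (sideLength ρ (N + 1)),
      periodicEnergy v Ψ ≤ periodicGroundStateEnergy v (N + 1) (sideLength ρ (N + 1)) + δ →
      ENNReal.ofReal c ≤ ENNReal.ofReal ((sideLength ρ (N + 1) ^ 3)⁻¹) *
      (‖∫ X in cellN N (sideLength ρ (N + 1)), conj (Θ.ψ X) *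
      ∫ x in cell (sideLength ρ (N + 1)), Ψ.ψ (vecCons x X)‖₊ : ℝ≥0∞) ^ 2) :
    CorrectorClosure :=
  correctorClosure_of_densityUniformHearts h₂
    (fun v hv hfin hC2 hedge =>
      stub_concentrationOfMoments v hv hfin hC2 hedge (stub_zeroModeFSum v hv hfin hC2 hedge)
        (zeroModeSusceptibility_of_torusGap v hv hfin hC2 hedge (hGap v hv hfin hC2 hedge)))
    hRRS hHole

end Summit.AtomisticToContinuum.BoseEinsteinCondensation.Theorems.CorrectorClosure.VolumeHomotopySumRuleDomination

end
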